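import Summits.QuantumFields.GaugeBoot.ERowCanon
import Summits.QuantumFields.GaugeBoot.GLYZc1D4RowLits
import HarnessLib

/-!
# Binding kit for the equality systems of the certified glyz-c1-4D problem files (rows C20–C31)

Cell `pub-gaugeboot` (HOME `run/shared/lean/pub/pub-gaugeboot/`), seat lean2 (FANOUT-PLAN A126 (2): per-β equality bindings).
The certified `SU(2)`, `D = 4`, GLYZ path-choice-1 problem files `certs/SU2-D4/glyz-c1/beta-<p>-<q>-{upper,lower}.problem1.json`
(one equality system per coupling, shared by the two ends) carry their equality rows in eng2's REDUCED form (`G2:direct(rref)`,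
labels in eng2's dialect).  Every such row is a rational combination of eng1's G1 rows, all of which are kernel theorems of
the torus theory (`GLYZc1D4SDRows`, `GLYZc1D4TraceRows`; as literals `GLYZc1D4RowLits.lit`).  This module is the shared, coupling-free
part of the per-β modules `Eqs/GLYZc1D4B<β>`: the CODED row format (`CRow`: terms `t <word code> <num> <den>`, combination entries
`l <λ num> <λ den> <lit def id> <position>`; words digit-coded by `wd`), the per-row KERNEL CHECK `cchk β₀`
(`GRow.canon` of the decoded row `=` `GRow.canon` of the combination of literal theorem rows evaluated at `β₀`), and the
soundness lemma `rowSum4_eq_zero_of_cchk`: a coded row passing the check vanishes on every torus `(ℤ/L)⁴`, `L ≥ 4`, at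
`β_std = β₀` (`ERowCanon.rowVal_eq_zero_of_canon_eq_lincomb`).  Nothing here is a certificate replay; positivity blocks are
not treated.

HONEST FRAMING (page 1 of every file of this cell): certified bounds on lattice expectations at STATED coupling, gauge
group, dimension and torus size; NOT a mass gap, NOT a continuum limit, NOT a string tension, NOT large `N`; NOT
Yang–Mills-summit-bearing (barriers `FixedCouplingUltralocality`, `PerturbativeInvisibility`).
-/

noncomputable section

open Literature.MathematicalPhysics.QuantumFieldTheory

namespace Summit.QuantumFields.GaugeBoot.GLYZc1D4

variable {L : ℕ} [NeZero L]

/-- Compact word literal: decimal digits, most significant first, digit `2μ + 1` = `+e_μ`, `2μ + 2` = `−e_μ` (`0` = empty word;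
e.g. `wd 1324` = `[+e₀, +e₁, −e₀, −e₁]`, the plaquette). -/
def wd (n : ℕ) : Word 4 := go n 40 where
  /-- digits of `n`, least significant consumed last; `fuel` (40 ≥ any label length here) bounds the recursion -/
  go : ℕ → ℕ → Word 4
    | _, 0 => []
    | n, fuel + 1 => if n = 0 then [] else
        go (n / 10) fuel ++ (let c := n % 10 - 1; if c % 2 = 0 then [Step.fwd ⟨c / 2 % 4, Nat.mod_lt _ (by decide)⟩] else [Step.bwd ⟨c / 2 % 4, Nat.mod_lt _ (by decide)⟩])

/-- `wd 1324` is the plaquette word. -/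
example : wd 1324 = [.fwd 0, .fwd 1, .bwd 0, .bwd 1] := by decide

/-- Coded term constructor `(word code, numerator, denominator)` (fixes the numeral types for fast elaboration). -/
def t (w : ℕ) (n : ℤ) (d : ℕ) : ℕ × ℤ × ℕ := (w, n, d)

/-- Coded combination entry `(λ numerator, λ denominator, literal def id, position)` (see `GLYZc1D4RowLits.lit`). -/
def l (n : ℤ) (d i k : ℕ) : ℤ × ℕ × ℕ × ℕ := (n, d, i, k)

/-- A CODED equality row: its terms and its combination witness. -/
abbrev CRow : Type := List (ℕ × ℤ × ℕ) × List (ℤ × ℕ × ℕ × ℕ)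

/-- Decode the terms of a coded row: `(word code, num, den)` ↦ `(wd code, num/den, 0)` (an `ERow4` with constant coefficients). -/
def decRow (ts : List (ℕ × ℤ × ℕ)) : ERow4 := ts.map fun t => (wd t.1, (t.2.1 : ℚ) / t.2.2, 0)

/-- Decode the combination witness: `(λ num, λ den, def id, position)` ↦ `(λ, (def id, position))`. -/
def decIdx (ls : List (ℤ × ℕ × ℕ × ℕ)) : List (ℚ × ℕ × ℕ) := ls.map fun l => ((l.1 : ℚ) / l.2.1, l.2.2)

/-- The combination named by `(λ, def id, position)` triples, over the literal theorem rows `GLYZc1D4RowLits.lit`. -/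
def combo (idx : List (ℚ × ℕ × ℕ)) : List (ℚ × ERow4) := idx.map fun q => (q.1, lit q.2)

/-- Every row of a combination vanishes on every torus with `L ≥ 4`. -/
theorem rowVal_combo (β : ℝ) (hL : 4 ≤ L) (idx : List (ℚ × ℕ × ℕ)) :
    ∀ p ∈ combo idx, rowVal β (Rung0D4.W β L) p.2 = 0 := by
  intro p hp
  obtain ⟨q, _, rfl⟩ := List.mem_map.1 hp
  rw [← rowSum4_eq_rowVal]; exact rowSum4_lit β hL q.2

/-- The decoded row of a coded row. -/
def CRow.row (c : CRow) : ERow4 := decRow c.1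

/-- **The per-row kernel check at coupling `β₀`**: the canonical form (`GRow.canon Word.ltw`: sorted by word, merged, zeros
dropped) of the decoded row equals that of its combination of literal theorem rows evaluated at `β_std = β₀`. -/
def cchk (β₀ : ℚ) (c : CRow) : Bool :=
  decide (GRow.canon Word.ltw (decRow c.1) = GRow.canon Word.ltw (GRow.evalAt β₀ (GRow.lincomb (combo (decIdx c.2)))))

/-- **Soundness of the check**: a coded row passing `cchk β₀` vanishes at `β_std = β₀` on every torus `(ℤ/L)⁴`, `L ≥ 4`. -/
theorem rowSum4_eq_zero_of_cchk (β₀ : ℚ) (hL : 4 ≤ L) (c : CRow) (h : cchk β₀ c = true) :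
    rowSum4 ((β₀ : ℚ) : ℝ) L c.row = 0 := by
  rw [rowSum4_eq_rowVal]
  exact rowVal_eq_zero_of_canon_eq_lincomb Word.ltw (Rung0D4.W _ L) β₀ (decRow c.1) (combo (decIdx c.2))
    (of_decide_eq_true h) (rowVal_combo _ hL (decIdx c.2))

/-- List form: if every coded row of `E` passes `cchk β₀`, every decoded row vanishes (`L ≥ 4`). -/
theorem rowSum4_eq_zero_of_all_cchk (β₀ : ℚ) (hL : 4 ≤ L) (E : List CRow) (h : E.all (cchk β₀) = true) :
    ∀ c ∈ E, rowSum4 ((β₀ : ℚ) : ℝ) L c.row = 0 :=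
  fun c hc => rowSum4_eq_zero_of_cchk β₀ hL c (List.all_eq_true.1 h c hc)

/-- Indexed form: row `j` of `E` (default: the empty row) vanishes (`L ≥ 4`). -/
theorem rowSum4_getD_eq_zero_of_all_cchk (β₀ : ℚ) (hL : 4 ≤ L) (E : List CRow) (h : E.all (cchk β₀) = true) (j : ℕ) :
    rowSum4 ((β₀ : ℚ) : ℝ) L (E.getD j ([], [])).row = 0 := by
  by_cases hj : j < E.length
  · rw [List.getD_eq_getElem _ _ hj]
    exact rowSum4_eq_zero_of_all_cchk β₀ hL E h _ (List.getElem_mem hj)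
  · rw [List.getD_eq_default _ _ (Nat.le_of_not_lt hj)]
    simp [CRow.row, decRow, rowSum4]

end Summit.QuantumFields.GaugeBoot.GLYZc1D4

end
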